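import Literature.MathematicalPhysics.QuantumFieldTheory.Balaban1983to89.B13LocalisationRemainderRoad
import Literature.MathematicalPhysics.QuantumFieldTheory.Balaban1983to89.Node00.OpsYDeltaALocal

/-!
# `Balaban1983to89.B13LocalisationRemainderRoadCubeLetters` — T. Bałaban, *Propagators for lattice gauge theories in a background field*, Commun. Math. Phys. **99**
# (1985) 389–434 [Balaban1985BackgroundPropagators], Thm 3.11 p. 416, (3.105)–(3.106) p. 414 («Δ_aG₀ = I − Σ_□K(h_□)G_□h_□ − … − Σ_□ζ_□(DPD\* − DP_□D\*)h_□G_□h_□ − … =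
# I − R»), Sect. C pp. 408–409 (the local operators `G′_□(U), C_□(U), G_□(U)`), (3.26)–(3.27) p. 395: THE ROW-17 FACE OF THE LOCALISATION ROAD AT node00-def-Y's
# DIRICHLET CUBE LETTERS — local operators `T_□ := Δ_{a,□}(U) = deltaALocY`, local inverses `G_□(U) = GAsqY`, `hloc` in the shape `PosDefTr 1 (padDeltaALocY … U)` that
# dag-n06-j's `…N06Row17LocalClauseOnReg335OfL5Letters` delivers per cube on print's class (3.35), and the DEFECT of the remainder read through def-Y's identity
# `Δ_{a,□}(U) − Δ_a(U) = D_U(R_□(U) − R(U))D\*_U` (`Node00.OpsYDeltaALocal.deltaALocY_sub_deltaAY`) — print's third sum of (3.105).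

statement-level bookkeeping (compositions BY NAME over the sibling `B13LocalisationRemainderRoad` and def-Y's definitional identities) with citation tags; kernel-checked;
THEOREMS ONLY (0 `def`, 0 instance, 0 notation); nothing here is a claim about the Yang–Mills mass gap; nothing of Bałaban's operators is asserted; no node is
discharged; count-neutral.

WHY THIS FILE (cell `pub-ymgap`, HUMAN RULING D-0062, Track A node N10 = [Balaban1988RG2Cluster] → N06 row 17; width seat `pub-ymgap-dag-n10-w6` g5; piece «L6» of the
N10 lane, third part).  The sibling states the row-17 face for an ARBITRARY local family `Tloc`; dag-n06-j's landed per-cube clause (`posDefTr_padDeltaALocY_of_L5_of_regYP335`,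
`…_of_ball_of_regYP335`) is about def-Y's `padDeltaALocY … (cubeDomY x c) (cutMulY χP) (cutMulY χ) U`.  THIS FILE pins `Tloc c := deltaALocY i (parSymY i) (parBY i) (Dc c)
(cutMulY (χP c))` so that (i) `hloc` is LITERALLY that clause per cube (`padDeltaALocY = dirPadY (cutMulY χ) Δ_{a,□}`, def-Y `rfl`), (ii) the local inverses are def-Y's
`GAsqY` (`= dirInvY (cutMulY χ) Δ_{a,□}`, def-Y `rfl`), and (iii) the defect letter `ε` is displayed on print's OWN defect operator `D_U(R_□(U) − R(U))D\*_U`.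

WHAT THIS FILE PROVES (all `theorem`s; carrier `FBondY i`, flat pairing, `G ≤ U(N)`, `G`-valued `U`, cubes indexed by any finite `ι` with site sets `Dc c`, block
cut-offs `χP c`, bond cut-offs `χ c`, partition `Σ_c h_c² = 1` supported in `{χ_c = 1}`).
* `toMatrix_deltaALocY_sub_deltaAY` — the defect identity in the product basis.
* ★★★ `deltaAY_parSymY_posDefTr_of_cubeLetters` — `PosDefTr 1 (deltaAY i (parSymY i) (parBY i) (GpY i (parSymY i)) U)` from: `hloc : ∀ c, PosDefTr 1 (padDeltaALocY i (parSymY i)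
  (parBY i) (Dc c) (cutMulY (χP c)) (cutMulY (χ c)) U)`; row ∕ column sums `≤ g` of the product-basis matrices of `GAsqY i (parSymY i) (parBY i) (Dc c) (cutMulY (χP c))
  (cutMulY (χ c)) U`; δ-first-moment row ∕ column sums `≤ κ` of `Δ_a(U)`'s; `|h_c|`-weighted row ∕ column sums `≤ ε` of `D_U(R_□(U) − R(U))D\*_U`'s; slowness `ω` and overlap
  `n` of the partition; and `n·g·(2ωκ + ε) < 1`.
* `GAY_parSymY_posDefTr_of_cubeLetters` — hence `PosDefTr 1 (GAY … U)`.

HONEST FRAMING: count-neutral Literature helper; every analytic input stays DISPLAYED — `hloc` (dag-n06-j's per-cube theorems on (3.35) supply it from the local-cube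
road's letters + `m_□`), the decay ∕ first moments of `Δ_a(U)`, the local inverses' row sums, the partition's slowness ∕ overlap, and the defect sums of `D(R_□ − R)D\*`
(print: Theorems 3.1–3.2 — NOT in the tree); finite-lattice constants, not print's `O(1)`; nothing of [Balaban1985BackgroundPropagators] Thm 3.11 ∕ Cor. 3.6 ∕ Thms 3.1–3.2
asserted; N06 ∕ N10 NOT discharged; K1⁹ NOT closed, no registered stub proved; counts unmoved; one finite 𝕋⁴ programme at fixed ε — R4 closes the conditional finite-𝕋⁴
rung `BalabanLadder.UV` only; nothing continuum ∕ ℝ⁴ ∕ OS ∕ mass gap ∕ Clay.  0 `sorry`, 0 `def`, standard axioms.  `--supports stmt-QuantumFields-27364` (K1⁹).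

References: [Balaban1985BackgroundPropagators] (3.25)–(3.27) pp.394–395, Sect. C pp.408–409, (3.87)–(3.89) pp.409–410, (3.105)–(3.106) p.414, Thm 3.11 p.416;
[Balaban1984PropagatorsII] Lemma 2.1 (2.61) p.234, p.235.
-/

noncomputable section

namespace Literature.MathematicalPhysics.QuantumFieldTheory.Balaban1983to89.B13LocalisationRemainderRoadCubeLetters

open Finset
open scoped Matrix Matrix.Norms.L2Operator
open Literature.MathematicalPhysics.QuantumFieldTheory.Balaban1983to89
open Literature.MathematicalPhysics.QuantumFieldTheory.Balaban1983to89.B9Thm311ReadingCoords (trIP PosDefTr)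
open Literature.MathematicalPhysics.QuantumFieldTheory.Balaban1983to89.B9Thm37CubeCoverCommutators (cutMulY)
open Literature.MathematicalPhysics.QuantumFieldTheory.Balaban1983to89.B13LocalisationRemainderRoad
  (deltaAY_parSymY_posDefTr_of_localFamily_of_letters)
open Literature.MathematicalPhysics.QuantumFieldTheory.Balaban1983to89.B9Thm311DeltaPrimePos (posDefTr_ringInverse)
open Literature.MathematicalPhysics.QuantumFieldTheory.Balaban1983to89.B6KLevelCensusIndexV1 (KIdx)
open Literature.MathematicalPhysics.QuantumFieldTheory.Balaban1983to89.Node00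
open Literature.MathematicalPhysics.QuantumFieldTheory.Balaban1983to89.Node00.OpsYLocalInverse (dirPadY dirInvY)
open Literature.MathematicalPhysics.QuantumFieldTheory.Balaban1983to89.Node00.OpsYDeltaALocal
  (deltaALocY padDeltaALocY GAsqY RlocY deltaALocY_sub_deltaAY padDeltaALocY_eq_dirPadY GAsqY_apply)

variable {d ℓ : ℕ} {hd : 1 ≤ d + 1} {hL : Odd (ℓ + 1) ∧ 1 < ℓ + 1} {b₀ b₁ : ℝ} {N : ℕ}
variable (i : KIdx d ℓ hd hL b₀ b₁) {G : Subgroup (Matrix (Fin N) (Fin N) ℂ)ˣ} {ι : Type} [Fintype ι] [DecidableEq ι]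

omit [Fintype ι] [DecidableEq ι] in
/-- the DEFECT IDENTITY in the product basis: `toMatrix(Δ_{a,□}(U)) − toMatrix(Δ_a(U)) = toMatrix(D_U(R_□(U) − R(U))D\*_U)` (def-Y's `deltaALocY_sub_deltaAY`).
[cite: Balaban1985BackgroundPropagators, (3.105) p.414 (Σζ_□(DPD\* − DP_□D\*)h_□G_□h_□), (3.26) p.395] -/
theorem toMatrix_deltaALocY_sub_deltaAY (Dc : Finset (SiteY i)) (P : Module.End ℂ (BlkY i → Matrix (Fin N) (Fin N) ℂ))
    (parS : SiteParY (Matrix (Fin N) (Fin N) ℂ) i) (parB : BondParY (Matrix (Fin N) (Fin N) ℂ) i) (Gp : SiteOpY (Matrix (Fin N) (Fin N) ℂ) i)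
    (U : CfgY (Matrix (Fin N) (Fin N) ℂ) i) :
    LinearMap.toMatrix ((Pi.basis fun _ : FBondY i => Matrix.stdBasis ℂ (Fin N) (Fin N)).reindex (Equiv.sigmaEquivProd (FBondY i) (Fin N × Fin N)))
        ((Pi.basis fun _ : FBondY i => Matrix.stdBasis ℂ (Fin N) (Fin N)).reindex (Equiv.sigmaEquivProd (FBondY i) (Fin N × Fin N))) (deltaALocY i parS parB Dc P U)
      - LinearMap.toMatrix ((Pi.basis fun _ : FBondY i => Matrix.stdBasis ℂ (Fin N) (Fin N)).reindex (Equiv.sigmaEquivProd (FBondY i) (Fin N × Fin N)))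
        ((Pi.basis fun _ : FBondY i => Matrix.stdBasis ℂ (Fin N) (Fin N)).reindex (Equiv.sigmaEquivProd (FBondY i) (Fin N × Fin N))) (deltaAY i parS parB Gp U)
      = LinearMap.toMatrix ((Pi.basis fun _ : FBondY i => Matrix.stdBasis ℂ (Fin N) (Fin N)).reindex (Equiv.sigmaEquivProd (FBondY i) (Fin N × Fin N)))
        ((Pi.basis fun _ : FBondY i => Matrix.stdBasis ℂ (Fin N) (Fin N)).reindex (Equiv.sigmaEquivProd (FBondY i) (Fin N × Fin N))) (gradY i U ∘ₗ (RlocY i parS Dc P U - RY i parS Gp U) ∘ₗ divY i U) := by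
  rw [← map_sub, deltaALocY_sub_deltaAY]

/-- ★★★ **ROW 17 AT def-Y's DIRICHLET CUBE LETTERS**: for `G ≤ U(N)` and a `G`-valued `U`, the certificate's `PosDefTr 1 (Δ_a(U))` follows from (i) dag-n06-j's per-cube clause
`PosDefTr 1 (padDeltaALocY i (parSymY i) (parBY i) (Dc c) (cutMulY (χP c)) (cutMulY (χ c)) U)` for every cube, (ii) the LETTERS — row ∕ column sums `≤ g` of the product-basis
matrices of the local inverses `G_□(U) = GAsqY …`, δ-first-moment row ∕ column sums `≤ κ` of `Δ_a(U)`'s, `|h_c|`-weighted row ∕ column sums `≤ ε` of print's defect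
`D_U(R_□(U) − R(U))D\*_U`'s, slowness `ω` and overlap `n` of the partition `Σ_c h_c² = 1` (`supp h_c ⊆ {χ_c = 1}`, `χ_c` 0∕1-valued) — and (iii) `n·g·(2ωκ + ε) < 1`.
[cite: Balaban1985BackgroundPropagators, Thm 3.11 p.416, (3.105)–(3.106) p.414, Sect. C pp.408–409, (3.87)–(3.89) pp.409–410; Balaban1984PropagatorsII, Lemma 2.1 (2.61) p.234, p.235] -/
theorem deltaAY_parSymY_posDefTr_of_cubeLetters (hG : G ≤ B7Prop2Explicit.unitaryUnits (Matrix (Fin N) (Fin N) ℂ))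
    {U : CfgY (Matrix (Fin N) (Fin N) ℂ) i} (hU : ∀ μ x, U μ x ∈ G)
    (Dc : ι → Finset (SiteY i)) (χP : ι → BlkY i → ℝ)
    (hf : ι → FBondY i → ℝ) (hsq : ∀ b, ∑ c, hf c b ^ 2 = 1) (χ : ι → FBondY i → ℝ) (hχ : ∀ c b, χ c b = 0 ∨ χ c b = 1)
    (hsupp : ∀ c b, hf c b ≠ 0 → χ c b = 1)
    (hloc : ∀ c, PosDefTr (fun _ => (1 : ℝ)) (padDeltaALocY i (parSymY i) (parBY i) (Dc c) (cutMulY (χP c)) (cutMulY (χ c)) U))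
    (δ : FBondY i × (Fin N × Fin N) → FBondY i × (Fin N × Fin N) → ℝ) {ω κ g ε : ℝ} {n : ℕ}
    (hω : 0 ≤ ω) (hδ : ∀ p s, 0 ≤ δ p s) (hg : 0 ≤ g) (hε : 0 ≤ ε)
    (hlip : ∀ c p s, |hf c p.1 - hf c s.1| ≤ ω * δ p s) (hov : ∀ b : FBondY i, (univ.filter fun c => hf c b ≠ 0).card ≤ n)
    (hGrow : ∀ c s, ∑ r, ‖LinearMap.toMatrix ((Pi.basis fun _ : FBondY i => Matrix.stdBasis ℂ (Fin N) (Fin N)).reindex (Equiv.sigmaEquivProd (FBondY i) (Fin N × Fin N)))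
        ((Pi.basis fun _ : FBondY i => Matrix.stdBasis ℂ (Fin N) (Fin N)).reindex (Equiv.sigmaEquivProd (FBondY i) (Fin N × Fin N))) (GAsqY i (parSymY i) (parBY i) (Dc c) (cutMulY (χP c)) (cutMulY (χ c)) U) s r‖ ≤ g)
    (hGcol : ∀ c r, ∑ s, ‖LinearMap.toMatrix ((Pi.basis fun _ : FBondY i => Matrix.stdBasis ℂ (Fin N) (Fin N)).reindex (Equiv.sigmaEquivProd (FBondY i) (Fin N × Fin N)))
        ((Pi.basis fun _ : FBondY i => Matrix.stdBasis ℂ (Fin N) (Fin N)).reindex (Equiv.sigmaEquivProd (FBondY i) (Fin N × Fin N))) (GAsqY i (parSymY i) (parBY i) (Dc c) (cutMulY (χP c)) (cutMulY (χ c)) U) s r‖ ≤ g)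
    (hTrow : ∀ p, ∑ s, ‖LinearMap.toMatrix ((Pi.basis fun _ : FBondY i => Matrix.stdBasis ℂ (Fin N) (Fin N)).reindex (Equiv.sigmaEquivProd (FBondY i) (Fin N × Fin N)))
        ((Pi.basis fun _ : FBondY i => Matrix.stdBasis ℂ (Fin N) (Fin N)).reindex (Equiv.sigmaEquivProd (FBondY i) (Fin N × Fin N))) (deltaAY i (parSymY i) (parBY i) (GpY i (parSymY i)) U) p s‖ * δ p s ≤ κ)
    (hTcol : ∀ s, ∑ p, ‖LinearMap.toMatrix ((Pi.basis fun _ : FBondY i => Matrix.stdBasis ℂ (Fin N) (Fin N)).reindex (Equiv.sigmaEquivProd (FBondY i) (Fin N × Fin N)))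
        ((Pi.basis fun _ : FBondY i => Matrix.stdBasis ℂ (Fin N) (Fin N)).reindex (Equiv.sigmaEquivProd (FBondY i) (Fin N × Fin N))) (deltaAY i (parSymY i) (parBY i) (GpY i (parSymY i)) U) p s‖ * δ p s ≤ κ)
    (hErow : ∀ c p, |hf c p.1| * ∑ s, ‖LinearMap.toMatrix ((Pi.basis fun _ : FBondY i => Matrix.stdBasis ℂ (Fin N) (Fin N)).reindex (Equiv.sigmaEquivProd (FBondY i) (Fin N × Fin N)))
        ((Pi.basis fun _ : FBondY i => Matrix.stdBasis ℂ (Fin N) (Fin N)).reindex (Equiv.sigmaEquivProd (FBondY i) (Fin N × Fin N))) (gradY i U ∘ₗ (RlocY i (parSymY i) (Dc c) (cutMulY (χP c)) U - RY i (parSymY i) (GpY i (parSymY i)) U) ∘ₗ divY i U) p s‖ ≤ ε)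
    (hEcol : ∀ c s, ∑ p, |hf c p.1| * ‖LinearMap.toMatrix ((Pi.basis fun _ : FBondY i => Matrix.stdBasis ℂ (Fin N) (Fin N)).reindex (Equiv.sigmaEquivProd (FBondY i) (Fin N × Fin N)))
        ((Pi.basis fun _ : FBondY i => Matrix.stdBasis ℂ (Fin N) (Fin N)).reindex (Equiv.sigmaEquivProd (FBondY i) (Fin N × Fin N))) (gradY i U ∘ₗ (RlocY i (parSymY i) (Dc c) (cutMulY (χP c)) U - RY i (parSymY i) (GpY i (parSymY i)) U) ∘ₗ divY i U) p s‖ ≤ ε)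
    (hθ : n * g * (2 * ω * κ + ε) < 1) :
    PosDefTr (fun _ => (1 : ℝ)) (deltaAY i (parSymY i) (parBY i) (GpY i (parSymY i)) U) := by
  have hE := fun c => toMatrix_deltaALocY_sub_deltaAY i (Dc c) (cutMulY (χP c)) (parSymY i) (parBY i) (GpY i (parSymY i)) U
  -- def-Y's `rfl` identities `padDeltaALocY_eq_dirPadY` ∕ `GAsqY_apply` and the defect identity, rewritten explicitly in the displayed hypotheses
  have hloc' : ∀ c, PosDefTr (fun _ => (1 : ℝ)) (dirPadY (cutMulY (χ c)) (deltaALocY i (parSymY i) (parBY i) (Dc c) (cutMulY (χP c)) U)) :=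
    fun c => by
      have h := hloc c
      rw [padDeltaALocY_eq_dirPadY] at h
      exact h
  have hGrow' : ∀ c s, ∑ r, ‖LinearMap.toMatrix ((Pi.basis fun _ : FBondY i => Matrix.stdBasis ℂ (Fin N) (Fin N)).reindex (Equiv.sigmaEquivProd (FBondY i) (Fin N × Fin N)))
        ((Pi.basis fun _ : FBondY i => Matrix.stdBasis ℂ (Fin N) (Fin N)).reindex (Equiv.sigmaEquivProd (FBondY i) (Fin N × Fin N))) (dirInvY (cutMulY (χ c)) (deltaALocY i (parSymY i) (parBY i) (Dc c) (cutMulY (χP c)) U)) s r‖ ≤ g :=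
    fun c s => by
      have h := hGrow c s
      rw [GAsqY_apply] at h
      exact h
  have hGcol' : ∀ c r, ∑ s, ‖LinearMap.toMatrix ((Pi.basis fun _ : FBondY i => Matrix.stdBasis ℂ (Fin N) (Fin N)).reindex (Equiv.sigmaEquivProd (FBondY i) (Fin N × Fin N)))
        ((Pi.basis fun _ : FBondY i => Matrix.stdBasis ℂ (Fin N) (Fin N)).reindex (Equiv.sigmaEquivProd (FBondY i) (Fin N × Fin N))) (dirInvY (cutMulY (χ c)) (deltaALocY i (parSymY i) (parBY i) (Dc c) (cutMulY (χP c)) U)) s r‖ ≤ g :=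
    fun c r => by
      have h := hGcol c r
      rw [GAsqY_apply] at h
      exact h
  have hErow' : ∀ c p, |hf c p.1| * ∑ s, ‖LinearMap.toMatrix ((Pi.basis fun _ : FBondY i => Matrix.stdBasis ℂ (Fin N) (Fin N)).reindex (Equiv.sigmaEquivProd (FBondY i) (Fin N × Fin N)))
        ((Pi.basis fun _ : FBondY i => Matrix.stdBasis ℂ (Fin N) (Fin N)).reindex (Equiv.sigmaEquivProd (FBondY i) (Fin N × Fin N))) (deltaALocY i (parSymY i) (parBY i) (Dc c) (cutMulY (χP c)) U) p s
        - LinearMap.toMatrix ((Pi.basis fun _ : FBondY i => Matrix.stdBasis ℂ (Fin N) (Fin N)).reindex (Equiv.sigmaEquivProd (FBondY i) (Fin N × Fin N)))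
        ((Pi.basis fun _ : FBondY i => Matrix.stdBasis ℂ (Fin N) (Fin N)).reindex (Equiv.sigmaEquivProd (FBondY i) (Fin N × Fin N))) (deltaAY i (parSymY i) (parBY i) (GpY i (parSymY i)) U) p s‖ ≤ ε :=
    fun c p => by
      have h := hErow c p
      rw [← hE c] at h
      simpa only [Matrix.sub_apply] using h
  have hEcol' : ∀ c s, ∑ p, |hf c p.1| * ‖LinearMap.toMatrix ((Pi.basis fun _ : FBondY i => Matrix.stdBasis ℂ (Fin N) (Fin N)).reindex (Equiv.sigmaEquivProd (FBondY i) (Fin N × Fin N)))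
        ((Pi.basis fun _ : FBondY i => Matrix.stdBasis ℂ (Fin N) (Fin N)).reindex (Equiv.sigmaEquivProd (FBondY i) (Fin N × Fin N))) (deltaALocY i (parSymY i) (parBY i) (Dc c) (cutMulY (χP c)) U) p s
        - LinearMap.toMatrix ((Pi.basis fun _ : FBondY i => Matrix.stdBasis ℂ (Fin N) (Fin N)).reindex (Equiv.sigmaEquivProd (FBondY i) (Fin N × Fin N)))
        ((Pi.basis fun _ : FBondY i => Matrix.stdBasis ℂ (Fin N) (Fin N)).reindex (Equiv.sigmaEquivProd (FBondY i) (Fin N × Fin N))) (deltaAY i (parSymY i) (parBY i) (GpY i (parSymY i)) U) p s‖ ≤ ε :=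
    fun c s => by
      have h := hEcol c s
      rw [← hE c] at h
      simpa only [Matrix.sub_apply] using h
  exact deltaAY_parSymY_posDefTr_of_localFamily_of_letters i hG hU
    (fun c => deltaALocY i (parSymY i) (parBY i) (Dc c) (cutMulY (χP c)) U) hf hsq χ hχ hsupp hloc' δ hω hδ hg hε hlip hov
    hGrow' hGcol' hTrow hTcol hErow' hEcol' hθ

/-- … hence `G(U) = Δ_a(U)⁻¹` (def-Y's `GAY`) is positive definite on the same inputs. [cite: Balaban1985BackgroundPropagators, Thm 3.11 p.416 («it is enough to prove it for G»), (3.27) p.395] -/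
theorem GAY_parSymY_posDefTr_of_cubeLetters (hG : G ≤ B7Prop2Explicit.unitaryUnits (Matrix (Fin N) (Fin N) ℂ))
    {U : CfgY (Matrix (Fin N) (Fin N) ℂ) i} (hU : ∀ μ x, U μ x ∈ G)
    (Dc : ι → Finset (SiteY i)) (χP : ι → BlkY i → ℝ)
    (hf : ι → FBondY i → ℝ) (hsq : ∀ b, ∑ c, hf c b ^ 2 = 1) (χ : ι → FBondY i → ℝ) (hχ : ∀ c b, χ c b = 0 ∨ χ c b = 1)
    (hsupp : ∀ c b, hf c b ≠ 0 → χ c b = 1)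
    (hloc : ∀ c, PosDefTr (fun _ => (1 : ℝ)) (padDeltaALocY i (parSymY i) (parBY i) (Dc c) (cutMulY (χP c)) (cutMulY (χ c)) U))
    (δ : FBondY i × (Fin N × Fin N) → FBondY i × (Fin N × Fin N) → ℝ) {ω κ g ε : ℝ} {n : ℕ}
    (hω : 0 ≤ ω) (hδ : ∀ p s, 0 ≤ δ p s) (hg : 0 ≤ g) (hε : 0 ≤ ε)
    (hlip : ∀ c p s, |hf c p.1 - hf c s.1| ≤ ω * δ p s) (hov : ∀ b : FBondY i, (univ.filter fun c => hf c b ≠ 0).card ≤ n)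
    (hGrow : ∀ c s, ∑ r, ‖LinearMap.toMatrix ((Pi.basis fun _ : FBondY i => Matrix.stdBasis ℂ (Fin N) (Fin N)).reindex (Equiv.sigmaEquivProd (FBondY i) (Fin N × Fin N)))
        ((Pi.basis fun _ : FBondY i => Matrix.stdBasis ℂ (Fin N) (Fin N)).reindex (Equiv.sigmaEquivProd (FBondY i) (Fin N × Fin N))) (GAsqY i (parSymY i) (parBY i) (Dc c) (cutMulY (χP c)) (cutMulY (χ c)) U) s r‖ ≤ g)
    (hGcol : ∀ c r, ∑ s, ‖LinearMap.toMatrix ((Pi.basis fun _ : FBondY i => Matrix.stdBasis ℂ (Fin N) (Fin N)).reindex (Equiv.sigmaEquivProd (FBondY i) (Fin N × Fin N)))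
        ((Pi.basis fun _ : FBondY i => Matrix.stdBasis ℂ (Fin N) (Fin N)).reindex (Equiv.sigmaEquivProd (FBondY i) (Fin N × Fin N))) (GAsqY i (parSymY i) (parBY i) (Dc c) (cutMulY (χP c)) (cutMulY (χ c)) U) s r‖ ≤ g)
    (hTrow : ∀ p, ∑ s, ‖LinearMap.toMatrix ((Pi.basis fun _ : FBondY i => Matrix.stdBasis ℂ (Fin N) (Fin N)).reindex (Equiv.sigmaEquivProd (FBondY i) (Fin N × Fin N)))
        ((Pi.basis fun _ : FBondY i => Matrix.stdBasis ℂ (Fin N) (Fin N)).reindex (Equiv.sigmaEquivProd (FBondY i) (Fin N × Fin N))) (deltaAY i (parSymY i) (parBY i) (GpY i (parSymY i)) U) p s‖ * δ p s ≤ κ)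
    (hTcol : ∀ s, ∑ p, ‖LinearMap.toMatrix ((Pi.basis fun _ : FBondY i => Matrix.stdBasis ℂ (Fin N) (Fin N)).reindex (Equiv.sigmaEquivProd (FBondY i) (Fin N × Fin N)))
        ((Pi.basis fun _ : FBondY i => Matrix.stdBasis ℂ (Fin N) (Fin N)).reindex (Equiv.sigmaEquivProd (FBondY i) (Fin N × Fin N))) (deltaAY i (parSymY i) (parBY i) (GpY i (parSymY i)) U) p s‖ * δ p s ≤ κ)
    (hErow : ∀ c p, |hf c p.1| * ∑ s, ‖LinearMap.toMatrix ((Pi.basis fun _ : FBondY i => Matrix.stdBasis ℂ (Fin N) (Fin N)).reindex (Equiv.sigmaEquivProd (FBondY i) (Fin N × Fin N)))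
        ((Pi.basis fun _ : FBondY i => Matrix.stdBasis ℂ (Fin N) (Fin N)).reindex (Equiv.sigmaEquivProd (FBondY i) (Fin N × Fin N))) (gradY i U ∘ₗ (RlocY i (parSymY i) (Dc c) (cutMulY (χP c)) U - RY i (parSymY i) (GpY i (parSymY i)) U) ∘ₗ divY i U) p s‖ ≤ ε)
    (hEcol : ∀ c s, ∑ p, |hf c p.1| * ‖LinearMap.toMatrix ((Pi.basis fun _ : FBondY i => Matrix.stdBasis ℂ (Fin N) (Fin N)).reindex (Equiv.sigmaEquivProd (FBondY i) (Fin N × Fin N)))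
        ((Pi.basis fun _ : FBondY i => Matrix.stdBasis ℂ (Fin N) (Fin N)).reindex (Equiv.sigmaEquivProd (FBondY i) (Fin N × Fin N))) (gradY i U ∘ₗ (RlocY i (parSymY i) (Dc c) (cutMulY (χP c)) U - RY i (parSymY i) (GpY i (parSymY i)) U) ∘ₗ divY i U) p s‖ ≤ ε)
    (hθ : n * g * (2 * ω * κ + ε) < 1) :
    PosDefTr (fun _ => (1 : ℝ)) (GAY i (parSymY i) (parBY i) (GpY i (parSymY i)) U) :=
  posDefTr_ringInverse (deltaAY_parSymY_posDefTr_of_cubeLetters i hG hU Dc χP hf hsq χ hχ hsupp hloc δ hω hδ hg hε hlip hov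
    hGrow hGcol hTrow hTcol hErow hEcol hθ)

end Literature.MathematicalPhysics.QuantumFieldTheory.Balaban1983to89.B13LocalisationRemainderRoadCubeLetters

end
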